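/-
Origin: expansion seat `planner-pub-hodgecm-toy2-g4-0`, handover #1a 2026-08-18T07:41:14Z (`HOME/pub-hodgecm-toy2-g4/lean/Toy2g4/PadH6.lean`, md5 6f4416f1, 913 lines);
landed by the gen-7 packager in gate run 26 as `HodgeCM/Model/PadH6.lean` (verbatim).
-/
/-
Copyright: pub-hodgecm formalisation cell (harness21, 2026). New file (not vendored).
Origin: HOME/pub-hodgecm-toy2-g4/lean/Toy2g4/PadH6.lean — session planner-pub-hodgecm-toy2-g4-0 (unit pub-hodgecm-toy2-g4,
CONSISTENCY seat 2, part (6a)(ii), generation 4).  WIP module `Toy2g4.PadH6`; intended final place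
`HodgeCM/Model/PadH6.lean` (module `HodgeCM.Model.PadH6`; kind L5 consistency / non-vacuity layer).  Imports are FINAL
package names; nothing to rewrite.
-/
import Summits.HodgeConjecture.HodgeCM.Geometry.CupFacts
import Summits.HodgeConjecture.HodgeCM.StubTree.Qw8Geometric
import Summits.HodgeConjecture.HodgeCM.StubTree.Inputs
import Summits.HodgeConjecture.HodgeCM.Model.Inhabited
import Summits.HodgeConjecture.HodgeCM.StubTree.Qw8Monomial_3

/-!
# Padding `H⁶`: a universe transform under which Pohlmann's span theorem fails

For ANY geometric universe `U` (the signature `HodgeCM.Universe`) let `U♯ := U.padH6` be the universe with the SAME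
varieties, dimensions, morphisms, products, CM abelian varieties, CM actions and Picard modular surfaces, the same
cohomology `H^k(X, ℚ)` with its Hodge structure, algebraic classes, pull-backs, cup products and traces in every degree
`k ≠ 6` — DEFINITIONALLY, through the degree-six pad combinator `HodgeCM.PadSix.Pad` (so that every statement of the
theory living in fixed degrees `0, 1, 2, 4, 8, …` holds in `U♯` by the very same proof term) — and in degree six

  `H♯⁶(X) := H⁶(X, ℚ) ⊕ H⁶(X, ℚ)`   (a second copy, the "pad"),

with: pull-backs acting DIAGONALLY (`f^* ⊕ f^*`); the Hodge structure `H⁶(X) ⊕ (H⁶(X, ℚ) purely of type (3,3))` (every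
pad vector is a rational Hodge class); algebraic classes `Alg³(X) ⊕ 0`; every cup product read through the first
summand and landing in the first summand (the pad is a square-zero, cup-orthogonal ideal); traces through the first
summand.

## Results (no hypothesis on `U` beyond the ones named; nothing cited; Lean + Mathlib axioms only)

* §0 `PadSix`: the combinator `Pad k A B` (`= A × B` for `k = 6`, `= A` otherwise, by pattern matching on `k`, so that
  `Pad 1 A B`, `Pad (2*2) A B`, `Pad (k+7) A B` REDUCE to `A`), its instances and structure maps `fst`, `snd`, `inl`,
  `inr`, `map`, `sub`, `hodge`, and their (eight-case) lemmas.
* §1 the transform `Universe.padH6`; §2 its API (`toU = fst`, `padOf = snd`, `ofU = inl`, `ofPad = inr`; transport of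
  `pull`, `cup`, `tr`, `alg`, `castCoh`, the Hodge filtrations `mem_F_iff`, complexifications `toUC`, `padOfC`).
* §3 transport of the composite notions (`pull_comm_iff`, `isDiagAct_iff`, `dim_prod4`).
* §4 **`PadH6.modelAxioms (M : U.ModelAxioms) (hd : U.Fact_dimProd) : U.padH6.ModelAxioms`** — all 28 model facts
  survive (`Fact_dimProd`, with M11, is used for M28 only: it puts the source degree `2(dim P - 2) = 8g - 4` of the
  algebraic self-duality off the padded degree `6`).  M26 (Gysin) survives WITHOUT any vanishing of traces.
* §5 N2 `Fact_cup_hodge`, N3 `Fact_pull_H0` (`Iff`), N4 `Fact_hodge_F0`, F4 `Fact_cupAlg`, F5 `Fact_cupAssoc`,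
  `Fact_dimProd` (`Iff`), `W_RK4` (`Iff`), `RealisationExistsFace/PerL` transfer; factor-wise CM actions and weight
  vectors are read componentwise (`cmProd_eq`, `isFactorAct_iff`, `isWeightVector_padOfC`, `isWeightVector_toUC`); every
  pad vector is a rational Hodge class (`ofPad_mem_hodgeClassesOf`) and is algebraic iff zero (`ofPad_mem_alg_iff`).
* §6 **`PadH6.not_pohlmannSpan (M : U.ModelAxioms) (hN1 : U.Fact_cupExterior) : ¬ U.padH6.PohlmannSpan`**: on
  `A′ = A_Φ⁶` over a Galois CM field of degree `≥ 6` (inhabited: `HodgeCM.faceHypothesesInhabited`, `F = ℚ(ζ₇)`) the pad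
  vectors `(0, v)` are rational Hodge classes of `H♯⁶`, the weight vectors of `U♯` of weight `S` project (second summand)
  to weight vectors of `U` of weight `S`, so Pohlmann's span inclusion in `U♯` would put ALL of `H⁶(A′, ℂ)` inside the sum
  of the Hodge-weight spaces of `U` — which misses the weight LINE (`finrank_weightSpace`, from `ModelAxioms` + N1) of the
  non-Hodge weight `({φ₀}, …, {φ₀})` (`not_isHodgeWeight_const_singleton`, `iSupIndep_weightSpace`).  Hence also
  **`not_fact_cupExterior`** (N1 FAILS in `U♯`: it is the load-bearing input of `pohlmannSpan_of_facts (M) (hN1) … (hN4)`),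
  `not_openInputs`, **`not_hc_cm`** (COR-CM fails: `H⁶(A_Φ) ≠ 0` carries non-algebraic pad Hodge classes), and the
  separation theorem `exists_model_not_pohlmannSpan`.

The unconditional instance `toyModel.padH6` and the independence theorem `pohlmannSpan_independent` are in
`HodgeCM.Model.Toy.ToyPadH6`.  No print meaning is claimed for `U♯` (it is not the cohomology of anything); it is a
consistency / independence device for the axiom system, like the exterior toy universe, `truncAlg` and `killH0`.
-/

noncomputable section

open scoped TensorProduct

namespace HodgeCM

open Literature.AlgebraicGeometry.Motives (CMType HodgeStructure)
open Literature.AlgebraicGeometry.Motives.HodgeStructure (EndAction ofRat complexConj prodEquiv pureFiltration)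

/-! ## 0. The degree-six pad combinator -/

namespace PadSix

/-- `Pad k A B`: the module `A × B` in degree `k = 6` and `A` in every other degree — by pattern matching, so that
`Pad 1 A B`, `Pad (2 * 2) A B`, `Pad (k + 7) A B` all reduce to `A` definitionally. -/
@[reducible] def Pad : ℕ → Type → Type → Type
  | 6, A, B => A × B
  | 0, A, _ => A
  | 1, A, _ => A
  | 2, A, _ => A
  | 3, A, _ => A
  | 4, A, _ => A
  | 5, A, _ => A
  | _ + 7, A, _ => A

section Inst

variable (A B : Type) [AddCommGroup A] [AddCommGroup B] [Module ℚ A] [Module ℚ B]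

/-- (Ported verbatim from the HodgeCMPerL package; no docstring in the source.) -/
@[reducible] instance instAddCommGroup : (k : ℕ) → AddCommGroup (Pad k A B)
  | 6 => inferInstanceAs (AddCommGroup (A × B))
  | 0 => inferInstanceAs (AddCommGroup A)
  | 1 => inferInstanceAs (AddCommGroup A)
  | 2 => inferInstanceAs (AddCommGroup A)
  | 3 => inferInstanceAs (AddCommGroup A)
  | 4 => inferInstanceAs (AddCommGroup A)
  | 5 => inferInstanceAs (AddCommGroup A)
  | _ + 7 => inferInstanceAs (AddCommGroup A)

/-- (Ported verbatim from the HodgeCMPerL package; no docstring in the source.) -/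
@[reducible] instance instModule : (k : ℕ) → Module ℚ (Pad k A B)
  | 6 => inferInstanceAs (Module ℚ (A × B))
  | 0 => inferInstanceAs (Module ℚ A)
  | 1 => inferInstanceAs (Module ℚ A)
  | 2 => inferInstanceAs (Module ℚ A)
  | 3 => inferInstanceAs (Module ℚ A)
  | 4 => inferInstanceAs (Module ℚ A)
  | 5 => inferInstanceAs (Module ℚ A)
  | _ + 7 => inferInstanceAs (Module ℚ A)

/-- (Ported verbatim from the HodgeCMPerL package; no docstring in the source.) -/
instance instFinite [Module.Finite ℚ A] [Module.Finite ℚ B] : (k : ℕ) → Module.Finite ℚ (Pad k A B)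
  | 6 => inferInstanceAs (Module.Finite ℚ (A × B))
  | 0 => inferInstanceAs (Module.Finite ℚ A)
  | 1 => inferInstanceAs (Module.Finite ℚ A)
  | 2 => inferInstanceAs (Module.Finite ℚ A)
  | 3 => inferInstanceAs (Module.Finite ℚ A)
  | 4 => inferInstanceAs (Module.Finite ℚ A)
  | 5 => inferInstanceAs (Module.Finite ℚ A)
  | _ + 7 => inferInstanceAs (Module.Finite ℚ A)

/-- The first projection `Pad k A B → A` (`Prod.fst` in degree `6`, the identity otherwise). -/
def fst : (k : ℕ) → Pad k A B →ₗ[ℚ] A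
  | 6 => LinearMap.fst ℚ A B
  | 0 => LinearMap.id
  | 1 => LinearMap.id
  | 2 => LinearMap.id
  | 3 => LinearMap.id
  | 4 => LinearMap.id
  | 5 => LinearMap.id
  | _ + 7 => LinearMap.id

/-- The pad projection `Pad k A B → B` (`Prod.snd` in degree `6`, zero otherwise). -/
def snd : (k : ℕ) → Pad k A B →ₗ[ℚ] B
  | 6 => LinearMap.snd ℚ A B
  | 0 => 0
  | 1 => 0
  | 2 => 0
  | 3 => 0
  | 4 => 0
  | 5 => 0
  | _ + 7 => 0

/-- The first inclusion `A → Pad k A B` (`(a, 0)` in degree `6`, the identity otherwise). -/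
def inl : (k : ℕ) → A →ₗ[ℚ] Pad k A B
  | 6 => LinearMap.inl ℚ A B
  | 0 => LinearMap.id
  | 1 => LinearMap.id
  | 2 => LinearMap.id
  | 3 => LinearMap.id
  | 4 => LinearMap.id
  | 5 => LinearMap.id
  | _ + 7 => LinearMap.id

/-- The pad inclusion `B → Pad k A B` (`(0, b)` in degree `6`, zero otherwise). -/
def inr : (k : ℕ) → B →ₗ[ℚ] Pad k A B
  | 6 => LinearMap.inr ℚ A B
  | 0 => 0
  | 1 => 0
  | 2 => 0
  | 3 => 0
  | 4 => 0
  | 5 => 0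
  | _ + 7 => 0

/-- A submodule of `A` as a submodule of `Pad k A B` (`S × 0` in degree `6`, `S` otherwise). -/
def sub : (k : ℕ) → Submodule ℚ A → Submodule ℚ (Pad k A B)
  | 6, S => S.prod ⊥
  | 0, S => S
  | 1, S => S
  | 2, S => S
  | 3, S => S
  | 4, S => S
  | 5, S => S
  | _ + 7, S => S

/-- Two Hodge structures, of weight `k` on `A` and of weight `6` on `B`, as one on `Pad k A B` (their direct sum in
degree `6`, the first one otherwise). -/
def hodge : (k : ℕ) → HodgeStructure A (k : ℤ) → HodgeStructure B ((6 : ℕ) : ℤ) → HodgeStructure (Pad k A B) (k : ℤ)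
  | 6, H₁, H₂ => H₁.prod H₂
  | 0, H₁, _ => H₁
  | 1, H₁, _ => H₁
  | 2, H₁, _ => H₁
  | 3, H₁, _ => H₁
  | 4, H₁, _ => H₁
  | 5, H₁, _ => H₁
  | _ + 7, H₁, _ => H₁

end Inst

section Map

variable {A A' A'' B B' B'' : Type} [AddCommGroup A] [AddCommGroup B] [Module ℚ A] [Module ℚ B]
  [AddCommGroup A'] [AddCommGroup B'] [Module ℚ A'] [Module ℚ B']
  [AddCommGroup A''] [AddCommGroup B''] [Module ℚ A''] [Module ℚ B'']

/-- Functoriality of `Pad k`: `f × g` in degree `6`, `f` otherwise. -/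
def map : (k : ℕ) → (A →ₗ[ℚ] A') → (B →ₗ[ℚ] B') → (Pad k A B →ₗ[ℚ] Pad k A' B')
  | 6, f, g => LinearMap.prodMap f g
  | 0, f, _ => f
  | 1, f, _ => f
  | 2, f, _ => f
  | 3, f, _ => f
  | 4, f, _ => f
  | 5, f, _ => f
  | _ + 7, f, _ => f

/-- (Ported verbatim from the HodgeCMPerL package; no docstring in the source.) -/
theorem fst_map (k : ℕ) (f : A →ₗ[ℚ] A') (g : B →ₗ[ℚ] B') (x : Pad k A B) :
    fst A' B' k (map k f g x) = f (fst A B k x) := by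
  rcases k with _|_|_|_|_|_|_|k <;> rfl

/-- (Ported verbatim from the HodgeCMPerL package; no docstring in the source.) -/
theorem snd_map (k : ℕ) (f : A →ₗ[ℚ] A') (g : B →ₗ[ℚ] B') (x : Pad k A B) :
    snd A' B' k (map k f g x) = g (snd A B k x) := by
  rcases k with _|_|_|_|_|_|_|k
  pick_goal 7
  · rfl
  all_goals exact (map_zero g).symm

/-- (Ported verbatim from the HodgeCMPerL package; no docstring in the source.) -/
theorem map_inl (k : ℕ) (f : A →ₗ[ℚ] A') (g : B →ₗ[ℚ] B') (a : A) :
    map k f g (inl A B k a) = inl A' B' k (f a) := by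
  rcases k with _|_|_|_|_|_|_|k
  pick_goal 7
  · exact Prod.ext rfl (map_zero g)
  all_goals rfl

/-- (Ported verbatim from the HodgeCMPerL package; no docstring in the source.) -/
theorem map_id (k : ℕ) : map k (LinearMap.id : A →ₗ[ℚ] A) (LinearMap.id : B →ₗ[ℚ] B) = LinearMap.id := by
  rcases k with _|_|_|_|_|_|_|k
  pick_goal 7
  · exact LinearMap.prodMap_id
  all_goals rfl

/-- (Ported verbatim from the HodgeCMPerL package; no docstring in the source.) -/
theorem map_comp (k : ℕ) (f : A →ₗ[ℚ] A') (f' : A' →ₗ[ℚ] A'') (g : B →ₗ[ℚ] B') (g' : B' →ₗ[ℚ] B'') :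
    map k (f' ∘ₗ f) (g' ∘ₗ g) = map k f' g' ∘ₗ map k f g := by
  rcases k with _|_|_|_|_|_|_|k
  pick_goal 7
  · exact (LinearMap.prodMap_comp f f' g g').symm
  all_goals rfl

/-- (Ported verbatim from the HodgeCMPerL package; no docstring in the source.) -/
theorem map_smul_id (k : ℕ) (c : ℚ) :
    map k (c • (LinearMap.id : A →ₗ[ℚ] A)) (c • (LinearMap.id : B →ₗ[ℚ] B)) = c • LinearMap.id := by
  rcases k with _|_|_|_|_|_|_|k
  pick_goal 7
  · exact LinearMap.ext fun x => rfl
  all_goals rfl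

end Map

section Lemmas

variable {A B : Type} [AddCommGroup A] [AddCommGroup B] [Module ℚ A] [Module ℚ B]

/-- (Ported verbatim from the HodgeCMPerL package; no docstring in the source.) -/
theorem fst_inl (k : ℕ) (a : A) : fst A B k (inl A B k a) = a := by
  rcases k with _|_|_|_|_|_|_|k <;> rfl

/-- (Ported verbatim from the HodgeCMPerL package; no docstring in the source.) -/
theorem snd_inl (k : ℕ) (a : A) : snd A B k (inl A B k a) = 0 := by
  rcases k with _|_|_|_|_|_|_|k <;> rfl

/-- (Ported verbatim from the HodgeCMPerL package; no docstring in the source.) -/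
theorem fst_inr (k : ℕ) (b : B) : fst A B k (inr A B k b) = 0 := by
  rcases k with _|_|_|_|_|_|_|k <;> rfl

/-- (Ported verbatim from the HodgeCMPerL package; no docstring in the source.) -/
theorem inl_fst_add_inr_snd (k : ℕ) (x : Pad k A B) : inl A B k (fst A B k x) + inr A B k (snd A B k x) = x := by
  rcases k with _|_|_|_|_|_|_|k
  pick_goal 7
  · exact Prod.ext (add_zero _) (zero_add _)
  all_goals exact add_zero _

/-- Off degree `6` the pad vanishes and `inl ∘ fst = id`. -/
theorem inl_fst_of_ne {k : ℕ} (hk : k ≠ 6) (x : Pad k A B) : inl A B k (fst A B k x) = x := by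
  rcases k with _|_|_|_|_|_|_|k
  pick_goal 7
  · exact absurd rfl hk
  all_goals rfl

/-- (Ported verbatim from the HodgeCMPerL package; no docstring in the source.) -/
theorem snd_of_ne {k : ℕ} (hk : k ≠ 6) (x : Pad k A B) : snd A B k x = 0 := by
  rcases k with _|_|_|_|_|_|_|k
  pick_goal 7
  · exact absurd rfl hk
  all_goals rfl

/-- (Ported verbatim from the HodgeCMPerL package; no docstring in the source.) -/
theorem inr_of_ne {k : ℕ} (hk : k ≠ 6) (b : B) : inr A B k b = 0 := by
  rcases k with _|_|_|_|_|_|_|k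
  pick_goal 7
  · exact absurd rfl hk
  all_goals rfl

/-- (Ported verbatim from the HodgeCMPerL package; no docstring in the source.) -/
theorem ext_iff' (k : ℕ) (x y : Pad k A B) : x = y ↔ fst A B k x = fst A B k y ∧ snd A B k x = snd A B k y := by
  constructor
  · rintro rfl; exact ⟨rfl, rfl⟩
  · rintro ⟨h1, h2⟩
    rw [← inl_fst_add_inr_snd k x, ← inl_fst_add_inr_snd k y, h1, h2]

/-- (Ported verbatim from the HodgeCMPerL package; no docstring in the source.) -/
theorem fst_injective_of_ne {k : ℕ} (hk : k ≠ 6) : Function.Injective (fst A B k) := fun x y h => by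
  rw [← inl_fst_of_ne hk x, ← inl_fst_of_ne hk y, h]

/-- (Ported verbatim from the HodgeCMPerL package; no docstring in the source.) -/
theorem fst_bijective_of_ne {k : ℕ} (hk : k ≠ 6) : Function.Bijective (fst A B k) :=
  ⟨fst_injective_of_ne hk, fun a => ⟨inl A B k a, fst_inl k a⟩⟩

/-- (Ported verbatim from the HodgeCMPerL package; no docstring in the source.) -/
theorem inl_injective (k : ℕ) : Function.Injective (inl A B k) := fun a b h => by
  rw [← fst_inl (B := B) k a, ← fst_inl (B := B) k b, h]

/-- (Ported verbatim from the HodgeCMPerL package; no docstring in the source.) -/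
theorem mem_sub_iff (k : ℕ) (S : Submodule ℚ A) (x : Pad k A B) :
    x ∈ sub A B k S ↔ fst A B k x ∈ S ∧ snd A B k x = 0 := by
  rcases k with _|_|_|_|_|_|_|k
  pick_goal 7
  · exact Submodule.mem_prod.trans (and_congr Iff.rfl (Submodule.mem_bot ℚ))
  all_goals exact ⟨fun h => ⟨h, rfl⟩, fun h => h.1⟩

/-! ### Complexification of the structure maps -/

/-- `prodEquiv` is `(fst ⊗ ℂ, snd ⊗ ℂ)`. -/
theorem prodEquiv_apply (x : ℂ ⊗[ℚ] (A × B)) :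
    prodEquiv A B x = ((LinearMap.fst ℚ A B).baseChange ℂ x, (LinearMap.snd ℚ A B).baseChange ℂ x) := by
  induction x using TensorProduct.induction_on with
  | zero => rw [map_zero, map_zero, map_zero]; rfl
  | tmul c v => simp [prodEquiv]
  | add x y hx hy => rw [map_add, hx, hy, map_add, map_add, Prod.mk_add_mk]

/-- (Ported verbatim from the HodgeCMPerL package; no docstring in the source.) -/
theorem baseChange_ofRat {M N : Type} [AddCommGroup M] [Module ℚ M] [AddCommGroup N] [Module ℚ N]
    (f : M →ₗ[ℚ] N) (m : M) : f.baseChange ℂ (ofRat m) = ofRat (f m) := by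
  rw [HodgeStructure.ofRat_apply, HodgeStructure.ofRat_apply, LinearMap.baseChange_tmul]

/-- A `ℂ`-subspace of `ℂ ⊗ M` containing all rational vectors is everything. -/
theorem eq_top_of_forall_ofRat_mem {M : Type} [AddCommGroup M] [Module ℚ M] {W : Submodule ℂ (ℂ ⊗[ℚ] M)}
    (h : ∀ m : M, ofRat m ∈ W) : W = ⊤ := by
  refine Submodule.eq_top_iff'.mpr fun z => ?_
  induction z using TensorProduct.induction_on with
  | zero => exact W.zero_mem
  | tmul c m =>
    have : c ⊗ₜ[ℚ] m = c • ofRat m := by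
      rw [HodgeStructure.ofRat_apply, TensorProduct.smul_tmul', smul_eq_mul, mul_one]
    rw [this]
    exact W.smul_mem c (h m)
  | add x y hx hy => exact W.add_mem hx hy

/-- Membership in the Hodge filtration of a direct sum, componentwise. -/
theorem mem_prod_F_iff {n : ℤ} (H₁ : HodgeStructure A n) (H₂ : HodgeStructure B n) (p : ℤ) (x : ℂ ⊗[ℚ] (A × B)) :
    x ∈ (H₁.prod H₂).F p ↔
      (LinearMap.fst ℚ A B).baseChange ℂ x ∈ H₁.F p ∧ (LinearMap.snd ℚ A B).baseChange ℂ x ∈ H₂.F p := by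
  show prodEquiv A B x ∈ (H₁.F p).prod (H₂.F p) ↔ _
  rw [prodEquiv_apply, Submodule.mem_prod]

/-- Membership in the Hodge filtration of `PadSix.hodge`, componentwise (the pad condition is vacuous off degree `6`). -/
theorem mem_hodge_F_iff (k : ℕ) (H₁ : HodgeStructure A (k : ℤ)) (H₂ : HodgeStructure B ((6 : ℕ) : ℤ)) (p : ℤ)
    (x : ℂ ⊗[ℚ] Pad k A B) :
    x ∈ (hodge A B k H₁ H₂).F p ↔ (fst A B k).baseChange ℂ x ∈ H₁.F p ∧ (snd A B k).baseChange ℂ x ∈ H₂.F p := by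
  rcases k with _|_|_|_|_|_|_|k
  pick_goal 7
  · exact mem_prod_F_iff H₁ H₂ p x
  all_goals
    rw [show fst A B _ = LinearMap.id from rfl, show snd A B _ = 0 from rfl, LinearMap.baseChange_id,
      LinearMap.baseChange_zero, LinearMap.zero_apply, LinearMap.id_apply]
    exact (and_iff_left (Submodule.zero_mem _)).symm

end Lemmas

end PadSix

/-! ## 1. The transform `U ↦ U♯ = U.padH6` -/

namespace Universe

variable (U : Universe)

/-- (Ported verbatim from the HodgeCMPerL package; no docstring in the source.) -/
theorem six_eq_two_mul_three : ((6 : ℕ) : ℤ) = 2 * 3 := by norm_num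

/-- The Hodge structure of the pad: `H⁶(X, ℚ)` purely of type `(3,3)`. -/
def padHodge (X : U.Var) : HodgeStructure (U.Coh X 6) ((6 : ℕ) : ℤ) :=
  HodgeStructure.pure (U.Coh X 6) 3 _ six_eq_two_mul_three


-- port_pkg: scope closed for this part
end Universe
end HodgeCM
end
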